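import Summits.BirchSwinnertonDyer.BirchSwinnertonDyer.Theorems.EdixhovenFibreFiveSevenOptimalManinUnitFiveSevenOfReciprocityLaw
import Summits.BirchSwinnertonDyer.BirchSwinnertonDyer.Theorems.AdditiveKolyvaginRoadManinFrameResidueProperROfKato
import HarnessLib

/-!
# Route `AdditiveKolyvaginRoad`, crux #7 `ManinFrameResidueProperR` (stmt-BirchSwinnertonDyer-20709) BY NAME, GRANTED ONLY
# {[REC-tower] (or hT₂), P1-bar} — no F″, no Fontaine cite, no Kato II Prop. 1.2.3 hypothesis, no Ihara lemma

Cell `pub/bsd-wall`, seat `bsd-line-edix-p1` g19 (LEAD of line `kato_lever` of crux K★ stmt-BirchSwinnertonDyer-22226, route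
EdixhovenFibreFiveSeven; this file `--supports` crux #7 stmt-BirchSwinnertonDyer-20709 of the sibling route AdditiveKolyvaginRoad as a helper —
same sub-problem, same rung W-ALL/2.p>=5.r1). TOOL theorems only (no definition, no named fact, no `sorry`); nothing is closed; BSD is not
proved by any of this.

WHAT. The crux's landed conditional closers read the proper Manin residue from Kato's integrality: `ManinFrameResidueProperROfKatoLTwist.maninFrameResidueProperR_of_kato`
(F″ alone, manin-p1 g8 + the transfer road) and `ManinFrameResidueProperROfSL2NeronValues.maninFrameResidueProperR_of_sl2NeronValues` (F″ assembled
from {P1, hT₂, Kato II Prop. 1.2.3, Fontaine's de Rham fact}). On the crux's OWN residue clause — «`p < 11` or some isogenous curve is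
(G)-ordinary with `ord_p Δ_min ≤ 4`» AND «some isogenous curve has no `Iₙ*` fibre at `p`» — the de Rham input is now a THEOREM (at `p ∈ {5, 7}`:
`DeRhamAtFiveSeven.isDeRham_adicCompletion_rat_fiveSeven`; at `p ≥ 11`: the (G)-ordinary member), Prop. 1.2.3 is the tree theorem
`cupLogInjective_and_hasDualExp_of_isDeRham_holds`, and P1 is read print-faithfully (P1-bar). So:

* ★★ `maninFrameResidueProperR_of_expStarTower_of_sl2NeronValuesBar : hT₂ → P1-bar → ManinFrameResidueProperR` — the optimal member `W₀ ∼ W`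
  (`X12.exists_isIsogenous_optimal`, `X12.exists_optimalDatum_of_level_eq`) gets `p ∤ c₀` from
  `OptimalManinUnitFiveSevenOfReciprocityLaw.not_dvd_optimal_c_fiveSeven_…` (`p ∈ {5, 7}`) /
  `…not_dvd_optimal_c_of_typeGOrd_member_…` (`p ≥ 11`); then prime-to-`p` transport (`ManinFrameTransport.exists_modularParametrizationData_not_dvd_of_partner`)
  and the Hoffstein–Luo odd Heegner frame (`ManinFrameFromDatum.exists_oddHeegnerFrame_of_exists_not_dvd`), as in the landed closers.
* ★★ `maninFrameResidueProperR_of_reciprocityLaw_of_sl2NeronValuesBar : [REC-tower] → P1-bar → ManinFrameResidueProperR`.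
* ★★ `wAllExclAdditive_of_closes_of_reciprocityLaw_of_sl2NeronValuesBar` — the route's leaf `WAllExclAdditive` through its own `closes` with
  crux #7 replaced by {[REC-tower], P1-bar}; all other hypotheses of `closes` verbatim.

CONDITIONAL on the two cite-only printed facts; the item stays OPEN; BSD is not proved by this.

References: [Kato2004Asterisque] Thm. 6.6 (1), (8.1.3), Thm. 9.7; [Kato1993LNM1553] Ch. II Thm. 1.4.1 (4), Prop. 1.2.3; [KostersPannekoek2017]
Thm. 1, Cor. 2; [HoffsteinLuo1997] Thm.; [EdixhovenManin1991] §4.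
-/

set_option autoImplicit false
-- the Theorems namespace of a single-conjunct summit repeats the summit name by design (D-0017)
set_option linter.dupNamespace false

noncomputable section

open scoped Classical MatrixGroups NumberField

open WeierstrassCurve NumberField IsDedekindDomain Field ValuativeRel
  Literature.NumberTheory.EllipticCurves Literature.NumberTheory.EllipticCurves.ModularForms
  Literature.NumberTheory.EllipticCurves.Rank1Residual Literature.NumberTheory.EllipticCurves.Kato2004
  Literature.NumberTheory.DiophantineGeometry Rat.HeightOneSpectrum
  Literature.NumberTheory.PAdicHodge Literature.NumberTheory.GaloisRepresentations
  Summit.BirchSwinnertonDyer.Rank1Residual Summit.BirchSwinnertonDyer.Rank1Residual.Additive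
  Summit.BirchSwinnertonDyer.BirchSwinnertonDyer.Theorems
  Summit.BirchSwinnertonDyer.BirchSwinnertonDyer.Theorems.OptimalManinUnitFiveSevenOfReciprocityLaw
  Summit.BirchSwinnertonDyer.BirchSwinnertonDyer.Theses.AdditiveKolyvaginRoad
  CongruenceSubgroup Complex

namespace Summit.BirchSwinnertonDyer.BirchSwinnertonDyer.Theorems.ManinFrameResidueProperROfReciprocityLaw

/-- ★★ **AKR crux #7 `ManinFrameResidueProperR` (stmt-BirchSwinnertonDyer-20709) GRANTED ONLY hT₂ and P1-bar** (modularity and Hoffstein–Luo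
come from the item's own bundle binder `PublishedInputsAdditiveKoly`; the Edixhoven / Dokchitser–Dokchitser binders and the
«all degrees divisible by `p`» clause are not used). Manin's `p`-part at the lattice-optimal datum of the optimal member: `p ∈ {5, 7}` by
`not_dvd_optimal_c_fiveSeven_of_expStarTower_of_sl2NeronValuesBar` (no `Iₙ*` from the residue clause, moved along the class), `p ≥ 11` by
`not_dvd_optimal_c_of_typeGOrd_member_of_expStarTower_of_sl2NeronValuesBar` (the (G)-ordinary member of the residue clause); transport and
frame as in `LTwistTransfer.maninFrameResidueProperR_of_kato_of_transferWitness`. CONDITIONAL; the item stays OPEN; BSD is not proved by this.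
[cite: Kato2004Asterisque, Thm. 6.6 (1) (p. 163), (8.1.3) (p. 180), Thm. 9.7 (p. 189)] [cite: Kato1993LNM1553, Ch. II Prop. 1.2.3 and Ex. 1.3.5]
[cite: KostersPannekoek2017, Thm. 1 and Cor. 2] [cite: HoffsteinLuo1997, Theorem (p. 1)] -/
theorem maninFrameResidueProperR_of_expStarTower_of_sl2NeronValuesBar
    (hT₂ : exists_smul_range_expStarCoord_tower_iff_trace_log) (hP1 : exists_member_sl2ZetaElement_neron_values_bar) :
    ManinFrameResidueProperR := by
  intro _e1 _e2 _dd hPub W _ _ p hp _ hp5 hadd hirr hres _hall hr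
  have hnf : exists_isNewformOf := hPub.2.2.2.2.2.1
  have hpr : p.Prime := hp.out
  have hp2 : p ≠ 2 := by omega
  -- the optimal member of the class of `W`, with its lattice-optimal datum at level `N(W)`
  obtain ⟨W₀, hE₀, hM₀, hNe₀, D₀'', hiso, hN, hopt''⟩ := X12.exists_isIsogenous_optimal hnf W
  haveI := hE₀
  haveI := hM₀
  haveI := hNe₀
  obtain ⟨D₀, hopt₀⟩ := X12.exists_optimalDatum_of_level_eq hN D₀'' hopt''
  have hadd₀ : Addv W₀ p := (X2.addv_iff_of_isIsogenous (p := p) hiso).mp hadd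
  have hirr₀ : Irr W₀ p := (X12.irr_iff_of_isIsogenous hiso p).mp hirr
  -- Manin's `p`-part at `D₀`
  have hc₀ : ¬ (p : ℤ) ∣ D₀.c := by
    obtain ⟨hord, W', hE', hM', hiso', hK'⟩ := hres
    haveI := hE'
    haveI := hM'
    by_cases hp7 : 7 < p
    · rcases hord with h11 | ⟨W'', hE'', hM'', hiso'', hG'', -⟩
      · exfalso
        interval_cases p <;> exact absurd hpr (by norm_num)
      · haveI := hE''
        haveI := hM''
        exact not_dvd_optimal_c_of_typeGOrd_member_of_expStarTower_of_sl2NeronValuesBar hT₂ hP1 hnf W₀ D₀ hp7 hadd₀ hirr₀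
          ⟨W'', hE'', hM'', (hiso.symm_of_charZero).trans' hiso'', hG''⟩ hopt₀
    · have hp57 : p = 5 ∨ p = 7 := by
        interval_cases p
        · exact Or.inl rfl
        · exact absurd hpr (by norm_num)
        · exact Or.inr rfl
      have hK₀ := (TeichmullerTwistDescent.forall_ne_Istar_iff_placeOf W₀ p).2
        (TeichmullerTwistDescent.forall_ne_Istar_of_member W₀ p hp2 ⟨W', hE', hM', (hiso.symm_of_charZero).trans' hiso', hK'⟩)
      exact not_dvd_optimal_c_fiveSeven_of_expStarTower_of_sl2NeronValuesBar hT₂ hP1 hnf W₀ D₀ hp57 hadd₀ hirr₀ hK₀ hopt₀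
  -- transport to a datum of `W` with `p ∤ c`, then the Hoffstein–Luo odd Heegner frame
  obtain ⟨Dt, hc⟩ := ManinFrameTransport.exists_modularParametrizationData_not_dvd_of_partner W hp.out hirr hiso D₀ hc₀
  exact ManinFrameFromDatum.exists_oddHeegnerFrame_of_exists_not_dvd hnf hPub.2.2.2.2.2.2.1 W p hr hp2 ⟨Dt, hc⟩

/-- ★★ **AKR crux #7 `ManinFrameResidueProperR` (stmt-BirchSwinnertonDyer-20709) GRANTED ONLY Kato's explicit reciprocity law [REC-tower] and
P1-bar** — the same two print-faithful published inputs as K★ (22226). CONDITIONAL; the item stays OPEN; BSD is not proved by this.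
[cite: Kato1993LNM1553, Ch. II Thm. 1.4.1 (4), Lemma 1.4.3–1.4.5] [cite: Kato2004Asterisque, (8.1.3) (p. 180), Thm. 9.7 (p. 189)] -/
theorem maninFrameResidueProperR_of_reciprocityLaw_of_sl2NeronValuesBar
    (hrec : tatePairingPoint_eq_trace_expStar_log_tower) (hP1 : exists_member_sl2ZetaElement_neron_values_bar) :
    ManinFrameResidueProperR :=
  maninFrameResidueProperR_of_expStarTower_of_sl2NeronValuesBar
    (exists_smul_range_expStarCoord_tower_iff_trace_log_of_reciprocityLaw hrec) hP1

/-- ★★ **The leaf `WAllExclAdditive` of route AdditiveKolyvaginRoad through its own deciding theorem `closes`, with crux #7 REPLACED by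
{[REC-tower], P1-bar}** — every other hypothesis of `closes` (the Kolyvagin-side cruxes 21400 / 20133 / 20134, `AdditiveAtThree` 20135, the
published Manin / Edixhoven / Dokchitser / ČNS facts, the class and glue items, the published-input bundle and the additive Kolyvagin kernel)
stays a hypothesis verbatim. CONDITIONAL; no item is closed; BSD is not proved and no W-ALL class theorem is proved by this.
[cite: Kato1993LNM1553, Ch. II Thm. 1.4.1 (4)] [cite: Kato2004Asterisque, (8.1.3) (p. 180), Thm. 9.7 (p. 189)] [cite: WZhang2014, Thm. 1.1] -/
theorem wAllExclAdditive_of_closes_of_reciprocityLaw_of_sl2NeronValuesBar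
    (hrec : tatePairingPoint_eq_trace_expStar_log_tower) (hP1 : exists_member_sl2ZetaElement_neron_values_bar)
    (h₁ : KolyvaginPrimitiveAdditive) (h₀ : RankZeroAdditive) (hoff : OffSharpRankOneAdditive) (h₃ : AdditiveAtThree)
    (e1 : EdixhovenManinNonPotOrdinary) (e2 : EdixhovenManinKodairaType) (dd : DokchitserIsogenyMinimalDiscriminant)
    (mz : MazurManinConstantOddPrimes) (au : AbbesUllmoManinConstantGoodPrimes) (c2 : CesnaviciusManinConstantAtTwo)
    (hOff : ManinFrameOffExceptionClass) (hIst : ManinFrameIstarClass) (g95 : ManinGoodOddFrameAdditiveResplitGlue)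
    (hC : CesnaviciusNeururerSahaManinDegree) (hD : ManinFrameResidueDegreeClass) (hP : PublishedInputsAdditiveKoly)
    (hK : AdditiveKolyvaginKernel) :
    Summit.BirchSwinnertonDyer.WAllExclAdditive :=
  closes h₁ h₀ hoff h₃ e1 e2 dd mz au c2 hOff hIst g95 hC hD
    (maninFrameResidueProperR_of_reciprocityLaw_of_sl2NeronValuesBar hrec hP1) hP hK

end Summit.BirchSwinnertonDyer.BirchSwinnertonDyer.Theorems.ManinFrameResidueProperROfReciprocityLaw

end
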